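import Literature.MathematicalPhysics.QuantumFieldTheory.O2CrossingNonVacuity
import Literature.MathematicalPhysics.QuantumFieldTheory.ONMixedNonVacuity
import HarnessLib

/-!
# Non-vacuity of the typed `O(2)` three-scalar axioms: three decoupled generalised free fields

`O2ThreeScalarSystem` types the hypotheses A1–A4 of the `O(2)` three-scalar bootstrap of Chester et al. (2020)
(`O2Data.SatisfiesO2Axioms X A`: genuine blocks, unitarity and spin parities, the grouped 22-row crossing
equation at every diamond point, the spectral assumptions `A : O2Gaps`) and the statements a certificate proves
(`BoxExcluded A Q`, `O2Enclosure A W R`).  `O2CrossingNonVacuity` showed at FUNCTION level that the Wick channel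
sums `gffSums` of three decoupled generalised free fields solve the flavour-space crossing equation.  This file
closes the remaining gap at AXIOM level: it builds an honest `O2Data` — spectrum, OPE coefficients and genuine
conformal blocks in every ordering — and proves that it satisfies A1–A4.

**The datum** (`gffTriple p q r`).  Externals: the doublet `φ` of dimension `p = Δ_φ`, the neutral scalar `s`
of dimension `q = Δ_s`, the charge-`2` scalar `t` of dimension `r = Δ_t`, pairwise decoupled generalised free
fields, `p, q, r > 1/2`; `λ_ext = (λ_sss, λ_{φφ̄s}, λ_{tt̄s}, λ_{φφt̄}) = 0`.  Exchanged primaries, sector by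
sector, all double-twist with mean-field-theory weights (`mftCoeff`, `gffOPECoeffSq`, `mftCoeffAB` of the
`ConformalBootstrap3D` tree; Fitzpatrick–Kaplan §2.2):
* `0⁺`: `[φφ̄]_{n,2m}` (`λ²_{φφ̄𝒪} = P_{n,2m}(p)`), `[tt̄]_{n,2m}` (`P_{n,2m}(r)`), `[ss]_{n,2m}` (`2P_{n,2m}(q)`);
* `0⁻`: `[φφ̄]_{n,2m+1}`, `[tt̄]_{n,2m+1}` (`P_{n,2m+1}`);
* `1`: `[φ̄s]_{n,ℓ}` (`λ²_{φs𝒪} = P_{n,ℓ}(p,q)`), `[tφ̄]_{n,ℓ}` (`λ²_{tφ𝒪} = P_{n,ℓ}(r,p)`), all spins;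
* `2⁺`: `[φφ]_{n,2m}` (`2P_{n,2m}(p)`) and the EVEN-spin `[ts]_{n,ℓ}` (`P_{n,ℓ}(r,q)`); `2⁻`: the ODD-spin `[ts]_{n,ℓ}`;
* `3`: `[tφ]_{n,ℓ}` (`P_{n,ℓ}(r,p)`), all spins; `4`: `[tt]_{n,2m}` (`2P_{n,2m}(r)`).
In every ordering `L` the block is the genuine mixed block `g^{Δ₁₂(L),Δ₃₄(L)}_{Δ,ℓ}(u,v)` (`genuineFamily`,
built from `ONMixedNonVacuity.blockUVAB`); §1 proves it IS a block in the sense of `IsBlockUV` (the series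
`h^{Δ₁₂,Δ₃₄}_{Δ,ℓ}(z,z̄)` is symmetric in `z ↔ z̄`, so the pull-back along `u = z z̄, v = (1−z)(1−z̄)` is the
`(z,z̄)`-form block characterised by `isConformalBlock3D_hrBlockAB_of_lt`).

**The proof of A3** goes through `O2CrossingDerivation.satisfiesCrossing_of_flavourCrossing`: sector by sector
and channel by channel the block expansions converge (§4; the tree's `(u,v)`-form mean-field decompositions
`hasSum_gffT`, `hasSum_gff1`, `hasSum_gffAsrc`, `hasSum_gffV1`, `hasSum_gffV2`, with the row signs `(−1)^ℓ` of
the charge-`1`/`3` families and the minus signs of the `0⁻`/`2⁻` rows absorbed exactly), the grouped totals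
are the Wick channel sums `gffSums (q, p, r)` AS FUNCTIONS (`totalSums_gffTriple`), and those are
`O(2)`-crossing symmetric at every `u, v > 0` (`o2CrossingAt_gff`).  The one non-elementary point is the split of
the all-spin `[ts]` family between `2⁺` (even spins) and `2⁻` (odd spins): the even part is the convergent sum
`EI`/`EII` over the even-spin index set, the odd part is the closed form minus it (`HasSum.hasSum_compl_iff`),
so the totals stay in closed form.

**Main statements** (§5).  `gffTriple_satisfiesO2Axioms : p,q,r > 1/2 → (gffTriple p q r).SatisfiesO2Axioms
(gffGaps p q r)` with `gffGaps p q r = ⟨min(2p,2q,2r), min(p+q,p+r), min(2p,q+r), p+r, 2r, 2min(p,q,r)−1⟩`;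
hence for every `A` weaker than `gffGaps p q r`: `BoxExcluded A Q → (q,p,r) ∉ Q` (`not_mem_of_boxExcluded`),
`O2Enclosure A W R → (q,p,r) ∈ W → (q,p,r) ∈ R` (`mem_of_o2Enclosure`).  And `not_chesterGaps_weaker`: the
source's assumptions (`Δ ≥ 3` for the further neutral and charged scalars) are NOT weaker than `gffGaps` when
`Δ_φ < 3/2`, so the decoupled triple does not obstruct the printed exclusions around the island — as it must not.

HONEST LIMITS.  (i) `λ_ext = 0`: in the decoupled theory `s ∉ φ × φ̄`, `t̄ ∉ φ × φ` etc.; the typed axioms leave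
`λ_ext` free, so this is admissible, but the witness exercises the `V⃗_ext` term only at zero.  (ii) The
spectrum has no stress tensor and no conserved current; the witness therefore says nothing about Ward-type
hypotheses (`O2WardObligations`), only about A1–A4 of `O2ThreeScalarSystem`.  (iii) The boundary `p, q, r = 1/2`
(free fields) is excluded: the genuine-block theorem used is the strict one.  (iv) This is a CONTROL on the typed
system and on any certificate pipeline feeding it (an exclusion `BoxExcluded A Q` with `A` weaker than
`gffGaps p q r` and `(q,p,r) ∈ Q` is refuted in the kernel), and an end-to-end kernel check of the sign and label
conventions of `O2ThreeScalarCrossing` / `O2CrossingDerivation`; it is not an island computation and carries no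
numerics.  HONEST FRAMING: shared numerical engines serving client cells; rigour lives in the verifiers; every
published number belongs to a client cell's ledger, not to the engines group.

Sources: Chester–Landry–Liu–Poland–Simmons-Duffin–Su–Vichi 2020 (§2.1 crossing equations and eq. (4point),
§2.2 assumptions about the spectrum, §3.1 unit and external contributions, §3.3 allowed and disallowed points);
Poland–Rychkov–Vichi 2019 §3.9.1 (generalised free fields, Wick's theorem); Fitzpatrick–Kaplan 2012 §2.2
(mean-field-theory OPE coefficients); Henriksson–van Loon 2018 §2 (the `O(N)` generalised free channel sums);
Dolan–Osborn 2004 §3 eq. (3.11) and Hogervorst–Rychkov 2013 §3 eq. (3.9) (the mixed blocks and their series).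
-/

noncomputable section

namespace Literature.MathematicalPhysics.QuantumFieldTheory.O2DecoupledNonVacuity

open Set
open Literature.MathematicalPhysics.QuantumFieldTheory.ConformalBootstrap3D
open Literature.MathematicalPhysics.QuantumFieldTheory.ONVectorNonVacuity
open Literature.MathematicalPhysics.QuantumFieldTheory.ONMixedNonVacuity
open Literature.MathematicalPhysics.QuantumFieldTheory.O2ThreeScalarCrossing
open Literature.MathematicalPhysics.QuantumFieldTheory.O2ThreeScalarSystem
open Literature.MathematicalPhysics.QuantumFieldTheory.O2CrossingDerivation
open Literature.MathematicalPhysics.QuantumFieldTheory.O2CrossingNonVacuity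

/-! ## §1 The `(u,v)`-form mixed blocks are genuine blocks in the sense of `O2ThreeScalarSystem.IsBlockUV` -/

section Blocks

variable (a b Δ : ℝ) (ℓ : ℕ)

/-- The double power series `h^{Δ₁₂,Δ₃₄}_{Δ,ℓ}(z, z̄)` is symmetric under `z ↔ z̄` (its coefficient table is,
`hrMonomialCoeffAB_symm`). [cite: HogervorstRychkov2013, §3 eq. (3.9) (symmetry of the expansion in z, z̄)]
[cite: DolanOsborn2004, §3 eq. (3.11)] -/
theorem hrSeriesAB_comm_args (z zb : ℝ) : hrSeriesAB a b Δ ℓ zb z = hrSeriesAB a b Δ ℓ z zb := by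
  unfold hrSeriesAB
  rw [← (Equiv.prodComm ℕ ℕ).tsum_eq (fun p : ℕ × ℕ => hrMonomialCoeffAB a b Δ ℓ p * z ^ p.1 * zb ^ p.2)]
  refine tsum_congr fun p => ?_
  obtain ⟨m, n⟩ := p
  simp only [Equiv.prodComm_apply, Prod.swap_prod_mk]
  rw [hrMonomialCoeffAB_symm a b Δ ℓ (m, n)]
  ring

/-- The mixed block `g^{Δ₁₂,Δ₃₄}_{Δ,ℓ}(z, z̄)` is symmetric under `z ↔ z̄`.
[cite: HogervorstRychkov2013, §3 eq. (3.9)] [cite: DolanOsborn2004, §3 eq. (3.11)] -/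
theorem hrBlockAB_comm_args (z zb : ℝ) : hrBlockAB a b Δ ℓ zb z = hrBlockAB a b Δ ℓ z zb := by
  unfold hrBlockAB
  rw [mul_comm zb z, hrSeriesAB_comm_args]

/-- Pulling the `(u,v)`-form mixed block back along `u = z z̄`, `v = (1−z)(1−z̄)` returns the `(z, z̄)`-form block
(the roots `zOfUV, zbOfUV` recover `{min, max}(z, z̄)`, and the block is symmetric).
[cite: DolanOsborn2004, §3 eq. (3.11)] [cite: HogervorstRychkov2013, §3 eq. (3.9)] -/
theorem pullbackZ_blockUVAB : pullbackZ (blockUVAB a b Δ ℓ) = hrBlockAB a b Δ ℓ := by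
  funext z zb
  simp only [pullbackZ, blockUVAB]
  rw [zOfUV_eq_min, zbOfUV_eq_max]
  rcases le_total z zb with h | h
  · rw [min_eq_left h, max_eq_right h]
  · rw [min_eq_right h, max_eq_left h, hrBlockAB_comm_args]

/-- **The `(u,v)`-form mixed block is a genuine block** (`IsBlockUV`): above the unitarity bound its pull-back is
the `(z, z̄)`-form block, which is characterised by the Casimir equation, the leading behaviour and real-analyticity
on the square (`isConformalBlock3D_hrBlockAB_of_lt`). [cite: DolanOsborn2004, §3 eq. (3.11)]
[cite: HogervorstRychkov2013, §3 eqs. (3.5), (3.9)] -/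
theorem isBlockUV_blockUVAB (hΔ : unitarityBound3D ℓ < Δ) : IsBlockUV a b Δ ℓ (blockUVAB a b Δ ℓ) := by
  unfold IsBlockUV
  rw [pullbackZ_blockUVAB]
  exact isConformalBlock3D_hrBlockAB_of_lt a b hΔ

end Blocks

/-- The block family of an exchanged primary `(Δ, ℓ)` in ALL orderings at once: ordering `L` carries the genuine
block with that ordering's external-dimension differences `(Δ₁₂, Δ₃₄) = (d12 D L, d34 D L)`.
[cite: ChesterEtAl2020, §3.1 (crossing equations: the blocks g^{Δ₁₂,Δ₃₄}_{Δ,ℓ})] -/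
def genuineFamily (D : Dims) (Δ : ℝ) (ℓ : ℕ) : Label → ℝ → ℝ → ℝ :=
  fun L => blockUVAB (d12 D L) (d34 D L) Δ ℓ

/-- `genuineFamily` is genuine on every set of orderings, above the unitarity bound.
[cite: ChesterEtAl2020, §3.1 (crossing equations)] [cite: DolanOsborn2004, §3 eq. (3.11)] -/
theorem genuineOn_genuineFamily (D : Dims) (S : List Label) {Δ : ℝ} {ℓ : ℕ}
    (hΔ : unitarityBound3D ℓ < Δ) : GenuineOn D S Δ ℓ (genuineFamily D Δ ℓ) :=
  fun L _ => isBlockUV_blockUVAB (d12 D L) (d34 D L) Δ ℓ hΔ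

/-! ## §2 The datum: decoupled generalised free fields `φ` (doublet, dimension `p`), `s` (singlet, `q`), `t` (charge 2, `r`) -/

section Datum

variable (p q r : ℝ)

/-- The external dimensions `(Δ_s, Δ_φ, Δ_t) = (q, p, r)`. [cite: ChesterEtAl2020, §3.1 (the external operators s, φ, t)] -/
def dims : Dims := ⟨q, p, r⟩

/-- Spins counted as even: the index set `{(n, ℓ) : ℓ even}` of the even-spin half of an all-spin double-twist
family. [cite: ChesterEtAl2020, Table (even/odd spin sectors)] -/
def evenSpin : Set (ℕ × ℕ) := {nl | Even nl.2}

/-! ### Sector `0⁺`: `[φφ̄]_{n,2m}`, `[t t̄]_{n,2m}`, `[ss]_{n,2m}` -/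

/-- Index set of sector `0⁺`. [cite: ChesterEtAl2020, §3.1] -/
abbrev I0p : Type := (ℕ × ℕ) ⊕ ((ℕ × ℕ) ⊕ (ℕ × ℕ))

/-- Dimensions in sector `0⁺`. [cite: FitzpatrickKaplan2012, §2.2 (double-twist dimensions 2Δ+2n+ℓ)] -/
def Δ0p : I0p → ℝ :=
  Sum.elim (fun nm => 2 * p + 2 * nm.1 + 2 * nm.2)
    (Sum.elim (fun nm => 2 * r + 2 * nm.1 + 2 * nm.2) (fun nm => 2 * q + 2 * nm.1 + 2 * nm.2))

/-- Spins in sector `0⁺` (even). [cite: FitzpatrickKaplan2012, §2.2] -/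
def ℓ0p : I0p → ℕ := Sum.elim (fun nm => 2 * nm.2) (Sum.elim (fun nm => 2 * nm.2) (fun nm => 2 * nm.2))

/-- `λ_{ss𝒪}` in sector `0⁺`: only `[ss]_{n,2m}`, weight `2 P_{n,2m}(q)`. [cite: FitzpatrickKaplan2012, §2.2]
[cite: HenrikssonVanLoon2018, §2 (a^{GFF})] -/
def a0 : I0p → ℝ := Sum.elim (fun _ => 0) (Sum.elim (fun _ => 0) (fun nm => Real.sqrt (gffOPECoeffSq q nm)))

/-- `λ_{φφ̄𝒪}` in sector `0⁺`: only `[φφ̄]_{n,2m}`, weight `P_{n,2m}(p)`. [cite: HenrikssonVanLoon2018, §2 (a_{T,Δ,ℓ})]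
[cite: FitzpatrickKaplan2012, §2.2] -/
def b0 : I0p → ℝ := Sum.elim (fun nm => Real.sqrt (mftCoeff p nm.1 (2 * nm.2))) (Sum.elim (fun _ => 0) (fun _ => 0))

/-- `λ_{t t̄𝒪}` in sector `0⁺`: only `[t t̄]_{n,2m}`, weight `P_{n,2m}(r)`. [cite: HenrikssonVanLoon2018, §2 (a_{T,Δ,ℓ})]
[cite: FitzpatrickKaplan2012, §2.2] -/
def c0 : I0p → ℝ := Sum.elim (fun _ => 0) (Sum.elim (fun nm => Real.sqrt (mftCoeff r nm.1 (2 * nm.2))) (fun _ => 0))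

/-! ### Sector `0⁻`: `[φφ̄]_{n,2m+1}`, `[t t̄]_{n,2m+1}` -/

/-- Index set of sector `0⁻`. [cite: ChesterEtAl2020, §3.1] -/
abbrev I0m : Type := (ℕ × ℕ) ⊕ (ℕ × ℕ)

/-- Dimensions in sector `0⁻`. [cite: FitzpatrickKaplan2012, §2.2] -/
def Δ0m : I0m → ℝ :=
  Sum.elim (fun nm => 2 * p + 2 * (nm.1 : ℕ) + ((2 * nm.2 + 1 : ℕ) : ℝ))
    (fun nm => 2 * r + 2 * (nm.1 : ℕ) + ((2 * nm.2 + 1 : ℕ) : ℝ))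

/-- Spins in sector `0⁻` (odd). [cite: FitzpatrickKaplan2012, §2.2] -/
def ℓ0m : I0m → ℕ := Sum.elim (fun nm => 2 * nm.2 + 1) (fun nm => 2 * nm.2 + 1)

/-- `λ_{φφ̄𝒪}` in sector `0⁻`, weight `P_{n,2m+1}(p)`. [cite: HenrikssonVanLoon2018, §2 (odd-spin coefficients)] -/
def b0m : I0m → ℝ := Sum.elim (fun nm => Real.sqrt (mftCoeff p nm.1 (2 * nm.2 + 1))) (fun _ => 0)

/-- `λ_{t t̄𝒪}` in sector `0⁻`, weight `P_{n,2m+1}(r)`. [cite: HenrikssonVanLoon2018, §2 (odd-spin coefficients)] -/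
def c0m : I0m → ℝ := Sum.elim (fun _ => 0) (fun nm => Real.sqrt (mftCoeff r nm.1 (2 * nm.2 + 1)))

/-! ### Sector `1`: `[φ̄ s]_{n,ℓ}`, `[t φ̄]_{n,ℓ}` (all spins) -/

/-- Index set of sector `1`. [cite: ChesterEtAl2020, §3.1] -/
abbrev I1 : Type := (ℕ × ℕ) ⊕ (ℕ × ℕ)

/-- Dimensions in sector `1`: `p+q+2n+ℓ` and `r+p+2n+ℓ`. [cite: FitzpatrickKaplan2012, §2.2 (Δ₁+Δ₂+2n+ℓ)] -/
def Δ1 : I1 → ℝ := Sum.elim (fun nl => p + q + 2 * nl.1 + nl.2) (fun nl => r + p + 2 * nl.1 + nl.2)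

/-- Spins in sector `1`. [cite: FitzpatrickKaplan2012, §2.2] -/
def ℓ1 : I1 → ℕ := Sum.elim (fun nl => nl.2) (fun nl => nl.2)

/-- `λ_{φs𝒪}`: only `[φ̄ s]`, weight `P_{n,ℓ}(p,q)`. [cite: FitzpatrickKaplan2012, §2.2] -/
def x1 : I1 → ℝ := Sum.elim (fun nl => Real.sqrt (mftCoeffAB p q nl.1 nl.2)) (fun _ => 0)

/-- `λ_{tφ𝒪}` (sector `1`): only `[t φ̄]`, weight `P_{n,ℓ}(r,p)`. [cite: FitzpatrickKaplan2012, §2.2] -/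
def y1 : I1 → ℝ := Sum.elim (fun _ => 0) (fun nl => Real.sqrt (mftCoeffAB r p nl.1 nl.2))

/-! ### Sectors `2⁺` / `2⁻`: `[φφ]_{n,2m}` and the even / odd halves of `[ts]_{n,ℓ}` -/

/-- Index set of sector `2⁺`. [cite: ChesterEtAl2020, §3.1] -/
abbrev I2p : Type := (ℕ × ℕ) ⊕ evenSpin

/-- Index set of sector `2⁻`: the odd-spin half of `[ts]`. [cite: ChesterEtAl2020, §3.1] -/
abbrev I2m : Type := (evenSpinᶜ : Set (ℕ × ℕ))

/-- Dimensions in sector `2⁺`. [cite: FitzpatrickKaplan2012, §2.2] -/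
def Δ2p : I2p → ℝ := Sum.elim (fun nm => 2 * p + 2 * nm.1 + 2 * nm.2) (fun i => r + q + 2 * i.1.1 + i.1.2)

/-- Spins in sector `2⁺`. [cite: FitzpatrickKaplan2012, §2.2] -/
def ℓ2p : I2p → ℕ := Sum.elim (fun nm => 2 * nm.2) (fun i => i.1.2)

/-- `λ_{φφ𝒪}` (sector `2⁺`): only `[φφ]_{n,2m}`, weight `2 P_{n,2m}(p)`. [cite: FitzpatrickKaplan2012, §2.2] -/
def b2 : I2p → ℝ := Sum.elim (fun nm => Real.sqrt (gffOPECoeffSq p nm)) (fun _ => 0)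

/-- `λ_{ts𝒪}` (sector `2⁺`): the even-spin `[ts]`, weight `P_{n,ℓ}(r,q)`. [cite: FitzpatrickKaplan2012, §2.2] -/
def z2 : I2p → ℝ := Sum.elim (fun _ => 0) (fun i => Real.sqrt (mftCoeffAB r q i.1.1 i.1.2))

/-- Dimensions in sector `2⁻`. [cite: FitzpatrickKaplan2012, §2.2] -/
def Δ2m : I2m → ℝ := fun i => r + q + 2 * i.1.1 + i.1.2

/-- Spins in sector `2⁻`. [cite: FitzpatrickKaplan2012, §2.2] -/
def ℓ2m : I2m → ℕ := fun i => i.1.2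

/-- `λ_{ts𝒪}` (sector `2⁻`): the odd-spin `[ts]`, weight `P_{n,ℓ}(r,q)`. [cite: FitzpatrickKaplan2012, §2.2] -/
def lam2m : I2m → ℝ := fun i => Real.sqrt (mftCoeffAB r q i.1.1 i.1.2)

/-! ### Sectors `3` and `4`: `[tφ]_{n,ℓ}` and `[tt]_{n,2m}` -/

/-- Dimensions in sector `3`. [cite: FitzpatrickKaplan2012, §2.2] -/
def Δ3 : ℕ × ℕ → ℝ := fun nl => r + p + 2 * nl.1 + nl.2

/-- `λ_{tφ𝒪}` (sector `3`), weight `P_{n,ℓ}(r,p)`. [cite: FitzpatrickKaplan2012, §2.2] -/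
def lam3 : ℕ × ℕ → ℝ := fun nl => Real.sqrt (mftCoeffAB r p nl.1 nl.2)

/-- Dimensions in sector `4`. [cite: FitzpatrickKaplan2012, §2.2] -/
def Δ4 : ℕ × ℕ → ℝ := fun nm => 2 * r + 2 * nm.1 + 2 * nm.2

/-- `λ_{tt𝒪}` (sector `4`), weight `2 P_{n,2m}(r)`. [cite: FitzpatrickKaplan2012, §2.2] -/
def lam4 : ℕ × ℕ → ℝ := fun nm => Real.sqrt (gffOPECoeffSq r nm)

/-- **The datum of three decoupled generalised free fields** `φ` (doublet, dimension `p`), `s` (neutral, `q`),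
`t` (charge `2`, `r`): external couplings `λ_sss = λ_{φφ̄s} = λ_{t t̄ s} = λ_{φφ t̄} = 0`, the double-twist
spectrum sector by sector, mean-field-theory couplings, and in every ordering the genuine mixed block.
[cite: ChesterEtAl2020, §3.1 (crossing equations)] [cite: PolandRychkovVichi2019, §3.9.1 (generalised free fields)]
[cite: FitzpatrickKaplan2012, §2.2] -/
def gffTriple : O2Data where
  D := dims p q r
  lam := 0
  gs := genuineFamily (dims p q r) q 0
  gφ := genuineFamily (dims p q r) p 0
  gt := genuineFamily (dims p q r) r 0
  ι0p := I0p
  Δ0p := Δ0p p q r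
  ℓ0p := ℓ0p
  a0 := a0 q
  b0 := b0 p
  c0 := c0 r
  g0p := fun i => genuineFamily (dims p q r) (Δ0p p q r i) (ℓ0p i)
  ι0m := I0m
  Δ0m := Δ0m p r
  ℓ0m := ℓ0m
  b0m := b0m p
  c0m := c0m r
  g0m := fun i => genuineFamily (dims p q r) (Δ0m p r i) (ℓ0m i)
  ι1 := I1
  Δ1 := Δ1 p q r
  ℓ1 := ℓ1
  x1 := x1 p q
  y1 := y1 p r
  g1 := fun i => genuineFamily (dims p q r) (Δ1 p q r i) (ℓ1 i)
  ι2p := I2p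
  Δ2p := Δ2p p q r
  ℓ2p := ℓ2p
  b2 := b2 p
  z2 := z2 q r
  g2p := fun i => genuineFamily (dims p q r) (Δ2p p q r i) (ℓ2p i)
  ι2m := I2m
  Δ2m := Δ2m q r
  ℓ2m := ℓ2m
  lam2m := lam2m q r
  g2m := fun i => genuineFamily (dims p q r) (Δ2m q r i) (ℓ2m i)
  ι3 := ℕ × ℕ
  Δ3 := Δ3 p r
  ℓ3 := fun nl => nl.2
  lam3 := lam3 p r
  g3 := fun i => genuineFamily (dims p q r) (Δ3 p r i) i.2
  ι4 := ℕ × ℕ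
  Δ4 := Δ4 r
  ℓ4 := fun nm => 2 * nm.2
  lam4 := lam4 r
  g4 := fun i => genuineFamily (dims p q r) (Δ4 r i) (2 * i.2)

/-- **The spectral assumptions met by the decoupled triple**: scalar thresholds `Δ0 = min(2p, 2q, 2r)`,
`Δ1 = min(p+q, p+r)`, `Δ2 = min(2p, q+r)`, `Δ3 = p+r`, `Δ4 = 2r` and twist gap `δτ = 2 min(p,q,r) − 1` (every
exchanged family is double-twist, of twist at least twice the smaller external dimension).
[cite: ChesterEtAl2020, §2.2 (assumptions about the spectrum)] [cite: FitzpatrickKaplan2012, §2.2] -/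
def gffGaps : O2Gaps :=
  ⟨min (2 * p) (min (2 * q) (2 * r)), min (p + q) (p + r), min (2 * p) (q + r), p + r, 2 * r,
    2 * min p (min q r) - 1⟩

/-! ## §3 The channel sums: closed forms, and the parity split of the `[ts]` family -/

/-- The signed `[ts]` family in the ordering `tsts` (`(Δ₁₂, Δ₃₄) = (r−q, r−q)`): `(−1)^ℓ P_{n,ℓ}(r,q) g^{r−q,r−q}`.
[cite: FitzpatrickKaplan2012, §2.2] [cite: ChesterEtAl2020, §3.1 (rows tsts of V⃗_{2±})] -/
def fI (u v : ℝ) (nl : ℕ × ℕ) : ℝ :=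
  (-1 : ℝ) ^ nl.2 * Real.sqrt (mftCoeffAB r q nl.1 nl.2) ^ 2 *
    blockUVAB (r - q) (r - q) (r + q + 2 * nl.1 + nl.2) nl.2 u v

/-- The `[ts]` family in the ordering `stts` (`(Δ₁₂, Δ₃₄) = (q−r, r−q)`): `P_{n,ℓ}(r,q) g^{q−r,r−q}`.
[cite: FitzpatrickKaplan2012, §2.2] [cite: ChesterEtAl2020, §3.1 (rows stts of V⃗_{2±})] -/
def fII (u v : ℝ) (nl : ℕ × ℕ) : ℝ :=
  Real.sqrt (mftCoeffAB r q nl.1 nl.2) ^ 2 * blockUVAB (q - r) (r - q) (r + q + 2 * nl.1 + nl.2) nl.2 u v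

/-- The even-spin part of `Σ (−1)^ℓ P g^{r−q,r−q}` (no elementary closed form for `q ≠ r`; a convergent sum).
[cite: ChesterEtAl2020, §3.1 (sector 2⁺, even spins)] [cite: FitzpatrickKaplan2012, §2.2] -/
def EI (u v : ℝ) : ℝ := ∑' i : evenSpin, fI q r u v i

/-- The even-spin part of `Σ P g^{q−r,r−q}`. [cite: ChesterEtAl2020, §3.1 (sector 2⁺, even spins)]
[cite: FitzpatrickKaplan2012, §2.2] -/
def EII (u v : ℝ) : ℝ := ∑' i : evenSpin, fII q r u v i

/-- Channel sums of sector `0⁺` (unit and externals excluded): `𝒢_T(p)`, `𝒢_T(r)`, `u^q + (u/v)^q`.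
[cite: HenrikssonVanLoon2018, §2 (𝒢^{(0)}_T, 𝒢^{(0)}_S)] [cite: ChesterEtAl2020, §3.1] -/
def S0p : Sec → ℝ → ℝ → ℝ
  | .φφφφ0p, u, v => gffT p u v
  | .tttt0p, u, v => gffT r u v
  | .ssss0p, u, v => gff1 q u v - 1
  | _, _, _ => 0

/-- Channel sums of sector `0⁻`: `½(u^p − (u/v)^p)`, `½(u^r − (u/v)^r)`. [cite: HenrikssonVanLoon2018, §2 (𝒢^{(0)}_A)]
[cite: ChesterEtAl2020, §3.1] -/
def S0m : Sec → ℝ → ℝ → ℝ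
  | .φφφφ0m, u, v => gffAsrc p u v
  | .tttt0m, u, v => gffAsrc r u v
  | _, _, _ => 0

/-- Channel sums of sector `1`: `u^{(p+q)/2} v^{−p}`, `u^{(p+q)/2}`, `u^{(p+r)/2} v^{−r}`, `u^{(p+r)/2}`.
[cite: PolandRychkovVichi2019, §3.9.1 (Wick's theorem)] [cite: ChesterEtAl2020, §3.1] -/
def S1 : Sec → ℝ → ℝ → ℝ
  | .sφφs1, u, v => u ^ ((p + q) / 2) / v ^ p
  | .φsφs1, u, _ => u ^ ((p + q) / 2)
  | .φttφ1, u, v => u ^ ((p + r) / 2) / v ^ r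
  | .tφtφ1, u, _ => u ^ ((p + r) / 2)
  | _, _, _ => 0

/-- Channel sums of sector `2⁺`: `u^p + (u/v)^p` and the even-spin parts `EI, EII` of the `[ts]` family.
[cite: PolandRychkovVichi2019, §3.9.1 (Wick's theorem)] [cite: ChesterEtAl2020, §3.1] -/
def S2p : Sec → ℝ → ℝ → ℝ
  | .φφφφ2, u, v => gff1 p u v - 1
  | .tsts2, u, v => EI q r u v
  | .stts2, u, v => EII q r u v
  | _, _, _ => 0

/-- Channel sums of sector `2⁻`: the odd-spin parts of the `[ts]` family, `u^{(q+r)/2} − EI` and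
`u^{(q+r)/2} v^{−r} − EII`. [cite: PolandRychkovVichi2019, §3.9.1 (Wick's theorem)] [cite: ChesterEtAl2020, §3.1] -/
def S2m : Sec → ℝ → ℝ → ℝ
  | .tsts2, u, v => u ^ ((q + r) / 2) - EI q r u v
  | .stts2, u, v => u ^ ((q + r) / 2) / v ^ r - EII q r u v
  | _, _, _ => 0

/-- Channel sums of sector `3`: `u^{(r+p)/2} v^{−r}`, `u^{(r+p)/2}`. [cite: PolandRychkovVichi2019, §3.9.1 (Wick's theorem)]
[cite: ChesterEtAl2020, §3.1] -/
def S3 : Sec → ℝ → ℝ → ℝ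
  | .φttφ3, u, v => u ^ ((p + r) / 2) / v ^ r
  | .tφtφ3, u, _ => u ^ ((p + r) / 2)
  | _, _, _ => 0

/-- Channel sum of sector `4`: `u^r + (u/v)^r`. [cite: PolandRychkovVichi2019, §3.9.1 (Wick's theorem)]
[cite: ChesterEtAl2020, §3.1] -/
def S4 : Sec → ℝ → ℝ → ℝ
  | .tttt4, u, v => gff1 r u v - 1
  | _, _, _ => 0

end Datum

/-! ## §4 Convergence of the conformal block expansions, sector by sector and channel by channel -/

section Sums

variable {p q r u v : ℝ}

/-- Plumbing: a family on `α ⊕ β` vanishing on the right sums to the sum of its left part. [folklore] -/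
private theorem hasSum_of_inl {α β : Type*} {f : α ⊕ β → ℝ} {a : ℝ} (h₁ : HasSum (fun x => f (Sum.inl x)) a)
    (h₂ : ∀ y, f (Sum.inr y) = 0) : HasSum f a := by
  have h2 : HasSum (f ∘ Sum.inr) 0 := by
    refine (hasSum_zero (α := ℝ) (β := β)).congr_fun fun y => ?_
    simp [h₂ y]
  simpa using HasSum.sum (f := f) h₁ h2

/-- Plumbing: a family on `α ⊕ β` vanishing on the left sums to the sum of its right part. [folklore] -/
private theorem hasSum_of_inr {α β : Type*} {f : α ⊕ β → ℝ} {a : ℝ} (h₁ : ∀ x, f (Sum.inl x) = 0)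
    (h₂ : HasSum (fun y => f (Sum.inr y)) a) : HasSum f a := by
  have h1 : HasSum (f ∘ Sum.inl) 0 := by
    refine (hasSum_zero (α := ℝ) (β := α)).congr_fun fun x => ?_
    simp [h₁ x]
  simpa using HasSum.sum (f := f) h1 h₂

/-- Plumbing: a family that vanishes identically sums to `0`. [folklore] -/
private theorem hasSum_zero_of_eq {ι : Type*} {f : ι → ℝ} (h : ∀ i, f i = 0) : HasSum f 0 := by
  refine (hasSum_zero (α := ℝ) (β := ι)).congr_fun fun i => ?_
  simp [h i]

/-- **Even double-twist family, neutral orderings**: `Σ_{n,m} P_{n,2m}(p) g_{2p+2n+2m,2m} = 𝒢_T(p) = ½(u^p + (u/v)^p)`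
with the genuine `(0,0)` blocks. [cite: HenrikssonVanLoon2018, §2 (𝒢^{(0)}_T, a_{T,Δ,ℓ})] [cite: FitzpatrickKaplan2012, §2.2] -/
theorem hasSum_evenFamily (hp : 1 / 2 < p) (h : InDiamond u v) :
    HasSum (fun nm : ℕ × ℕ => Real.sqrt (mftCoeff p nm.1 (2 * nm.2)) ^ 2 *
      blockUVAB 0 0 (2 * p + 2 * nm.1 + 2 * nm.2) (2 * nm.2) u v) (gffT p u v) := by
  refine (hasSum_gffT hp h).congr_fun fun nm => ?_
  rw [Real.sq_sqrt (mftCoeff_nonneg hp _ _), blockUVAB_zero_zero]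

/-- **Even double-twist family with the doubled weights** `2 P_{n,2m}(p)`: `Σ = u^p + (u/v)^p` (a single generalised
free field, or the charge-`2` / charge-`4` channel of a complex one). [cite: HenrikssonVanLoon2018, §2 (𝒢^{(0)}_S, N = 1)]
[cite: FitzpatrickKaplan2012, §2.2] -/
theorem hasSum_evenFamily_two (hp : 1 / 2 < p) (h : InDiamond u v) :
    HasSum (fun nm : ℕ × ℕ => Real.sqrt (gffOPECoeffSq p nm) ^ 2 *
      blockUVAB 0 0 (2 * p + 2 * nm.1 + 2 * nm.2) (2 * nm.2) u v) (gff1 p u v - 1) := by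
  refine (hasSum_gff1 hp h).congr_fun fun nm => ?_
  rw [Real.sq_sqrt (gffOPECoeffSq_pos hp nm).le, blockUVAB_zero_zero]

/-- **Odd double-twist family, neutral orderings, with the sign of the `0⁻` rows**:
`−Σ_{n,m} P_{n,2m+1}(p) g_{2p+2n+2m+1,2m+1} = ½(u^p − (u/v)^p)`. [cite: HenrikssonVanLoon2018, §2 (𝒢^{(0)}_A, odd spins)]
[cite: ChesterEtAl2020, §3.1 (the sign of the 0⁻ rows)] -/
theorem hasSum_oddFamily (hp : 1 / 2 < p) (h : InDiamond u v) :
    HasSum (fun nm : ℕ × ℕ => -(Real.sqrt (mftCoeff p nm.1 (2 * nm.2 + 1)) ^ 2 *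
      blockUVAB 0 0 (2 * p + 2 * (nm.1 : ℕ) + ((2 * nm.2 + 1 : ℕ) : ℝ)) (2 * nm.2 + 1) u v)) (gffAsrc p u v) := by
  refine (hasSum_gffAsrc hp h).congr_fun fun nm => ?_
  rw [Real.sq_sqrt (mftCoeff_nonneg hp _ _), blockUVAB_zero_zero, srcBlockUV,
    Odd.neg_one_pow (odd_two_mul_add_one nm.2)]
  ring

/-- **Mixed family, type (I) orderings** (`φsφs`, `tφtφ`, `tsts`): `Σ_{n,ℓ} (−1)^ℓ P_{n,ℓ}(p,q) g^{p−q,p−q}_{p+q+2n+ℓ,ℓ}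
= u^{(p+q)/2}`. [cite: FitzpatrickKaplan2012, §2.2] [cite: PolandRychkovVichi2019, §3.9.1 (Wick's theorem)] -/
theorem hasSum_typeI (hp : 1 / 2 < p) (hq : 1 / 2 < q) (h : InDiamond u v) :
    HasSum (fun nl : ℕ × ℕ => (-1 : ℝ) ^ nl.2 * Real.sqrt (mftCoeffAB p q nl.1 nl.2) ^ 2 *
      blockUVAB (p - q) (p - q) (p + q + 2 * nl.1 + nl.2) nl.2 u v) (u ^ ((p + q) / 2)) := by
  refine (hasSum_gffV1 hp hq h).congr_fun fun nl => ?_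
  rw [Real.sq_sqrt (mftCoeffAB_nonneg hp hq _ _), srcBlockUVAB]
  ring

/-- **Mixed family, type (II) orderings** (`sφφs`, `φttφ`, `stts`): `Σ_{n,ℓ} P_{n,ℓ}(p,q) g^{q−p,p−q}_{p+q+2n+ℓ,ℓ}
= u^{(p+q)/2} v^{−p}`. [cite: FitzpatrickKaplan2012, §2.2] [cite: PolandRychkovVichi2019, §3.9.1 (Wick's theorem)] -/
theorem hasSum_typeII (hp : 1 / 2 < p) (hq : 1 / 2 < q) (h : InDiamond u v) :
    HasSum (fun nl : ℕ × ℕ => Real.sqrt (mftCoeffAB p q nl.1 nl.2) ^ 2 *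
      blockUVAB (q - p) (p - q) (p + q + 2 * nl.1 + nl.2) nl.2 u v) (u ^ ((p + q) / 2) / v ^ p) := by
  refine (hasSum_gffV2 hp hq h).congr_fun fun nl => ?_
  have hsq : (-1 : ℝ) ^ nl.2 * (-1 : ℝ) ^ nl.2 = 1 := by
    rw [← mul_pow]
    norm_num
  rw [Real.sq_sqrt (mftCoeffAB_nonneg hp hq _ _), srcBlockUVAB, neg_sub]
  linear_combination (-(mftCoeffAB p q nl.1 nl.2 *
    blockUVAB (q - p) (p - q) (p + q + 2 * nl.1 + nl.2) nl.2 u v)) * hsq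

/-- The whole signed `tsts` family sums to `u^{(q+r)/2}`. [cite: FitzpatrickKaplan2012, §2.2]
[cite: PolandRychkovVichi2019, §3.9.1 (Wick's theorem)] -/
theorem hasSum_fI (hq : 1 / 2 < q) (hr : 1 / 2 < r) (h : InDiamond u v) :
    HasSum (fI q r u v) (u ^ ((q + r) / 2)) := by
  have e : u ^ ((q + r) / 2) = u ^ ((r + q) / 2) := by rw [add_comm]
  rw [e]
  refine (hasSum_typeI hr hq h).congr_fun fun nl => ?_
  simp only [fI]

/-- The whole `stts` family sums to `u^{(q+r)/2} v^{−r}`. [cite: FitzpatrickKaplan2012, §2.2]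
[cite: PolandRychkovVichi2019, §3.9.1 (Wick's theorem)] -/
theorem hasSum_fII (hq : 1 / 2 < q) (hr : 1 / 2 < r) (h : InDiamond u v) :
    HasSum (fII q r u v) (u ^ ((q + r) / 2) / v ^ r) := by
  have e : u ^ ((q + r) / 2) / v ^ r = u ^ ((r + q) / 2) / v ^ r := by rw [add_comm]
  rw [e]
  refine (hasSum_typeII hr hq h).congr_fun fun nl => ?_
  simp only [fII]

/-- The even-spin part of the `tsts` family converges, to `EI`. [cite: ChesterEtAl2020, §3.1 (sector 2⁺)]
[cite: FitzpatrickKaplan2012, §2.2] -/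
theorem hasSum_fI_even (hq : 1 / 2 < q) (hr : 1 / 2 < r) (h : InDiamond u v) :
    HasSum (fun i : evenSpin => fI q r u v i) (EI q r u v) :=
  ((hasSum_fI hq hr h).summable.subtype evenSpin).hasSum

/-- The even-spin part of the `stts` family converges, to `EII`. [cite: ChesterEtAl2020, §3.1 (sector 2⁺)]
[cite: FitzpatrickKaplan2012, §2.2] -/
theorem hasSum_fII_even (hq : 1 / 2 < q) (hr : 1 / 2 < r) (h : InDiamond u v) :
    HasSum (fun i : evenSpin => fII q r u v i) (EII q r u v) :=
  ((hasSum_fII hq hr h).summable.subtype evenSpin).hasSum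

/-- The odd-spin part of the `tsts` family converges, to `u^{(q+r)/2} − EI`. [cite: ChesterEtAl2020, §3.1 (sector 2⁻)]
[cite: FitzpatrickKaplan2012, §2.2] -/
theorem hasSum_fI_odd (hq : 1 / 2 < q) (hr : 1 / 2 < r) (h : InDiamond u v) :
    HasSum (fun i : (evenSpinᶜ : Set (ℕ × ℕ)) => fI q r u v i) (u ^ ((q + r) / 2) - EI q r u v) := by
  have he : HasSum (fI q r u v ∘ (↑) : evenSpin → ℝ) (EI q r u v) := hasSum_fI_even hq hr h
  have ht : HasSum (fI q r u v) (EI q r u v + (u ^ ((q + r) / 2) - EI q r u v)) := by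
    have e : EI q r u v + (u ^ ((q + r) / 2) - EI q r u v) = u ^ ((q + r) / 2) := by ring
    rw [e]
    exact hasSum_fI hq hr h
  exact (HasSum.hasSum_compl_iff (f := fI q r u v) (s := evenSpin) he).mpr ht

/-- The odd-spin part of the `stts` family converges, to `u^{(q+r)/2} v^{−r} − EII`.
[cite: ChesterEtAl2020, §3.1 (sector 2⁻)] [cite: FitzpatrickKaplan2012, §2.2] -/
theorem hasSum_fII_odd (hq : 1 / 2 < q) (hr : 1 / 2 < r) (h : InDiamond u v) :
    HasSum (fun i : (evenSpinᶜ : Set (ℕ × ℕ)) => fII q r u v i) (u ^ ((q + r) / 2) / v ^ r - EII q r u v) := by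
  have he : HasSum (fII q r u v ∘ (↑) : evenSpin → ℝ) (EII q r u v) := hasSum_fII_even hq hr h
  have ht : HasSum (fII q r u v) (EII q r u v + (u ^ ((q + r) / 2) / v ^ r - EII q r u v)) := by
    have e : EII q r u v + (u ^ ((q + r) / 2) / v ^ r - EII q r u v) = u ^ ((q + r) / 2) / v ^ r := by ring
    rw [e]
    exact hasSum_fII hq hr h
  exact (HasSum.hasSum_compl_iff (f := fII q r u v) (s := evenSpin) he).mpr ht

/-! ### The seven sectors, channel by channel -/

/-- **Sector `0⁺`**: the `0⁺` block expansion of the decoupled triple converges, channel by channel, to `S0p`.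
[cite: ChesterEtAl2020, §2.1 (eq. (4point))] [cite: HenrikssonVanLoon2018, §2 (𝒢^{(0)}_T, 𝒢^{(0)}_S)] -/
theorem sector0p_hasSum (hp : 1 / 2 < p) (hq : 1 / 2 < q) (hr : 1 / 2 < r) (h : InDiamond u v) (σ : Sec) :
    HasSum (fun i => sec0p ((gffTriple p q r).a0 i) ((gffTriple p q r).b0 i) ((gffTriple p q r).c0 i)
      ((gffTriple p q r).g0p i) σ u v) (S0p p q r σ u v) := by
  have hba : ∀ i : I0p, b0 p i * a0 q i = 0 := by rintro (nm | nm | nm) <;> simp [a0, b0]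
  have hca : ∀ i : I0p, c0 r i * a0 q i = 0 := by rintro (nm | nm | nm) <;> simp [a0, c0]
  have hcb : ∀ i : I0p, c0 r i * b0 p i = 0 := by rintro (nm | nm | nm) <;> simp [b0, c0]
  cases σ <;> simp only [gffTriple, sec0p, S0p, hba, hca, hcb, zero_mul] <;> try exact hasSum_zero
  case φφφφ0p =>
    refine hasSum_of_inl ?_ (fun j => by rcases j with nm | nm <;> simp [b0])
    refine (hasSum_evenFamily hp h).congr_fun fun nm => ?_
    simp only [b0, Δ0p, ℓ0p, Sum.elim_inl, genuineFamily, d12, d34]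
  case tttt0p =>
    refine hasSum_of_inr (fun nm => by simp [c0]) (hasSum_of_inl ?_ (fun nm => by simp [c0]))
    refine (hasSum_evenFamily hr h).congr_fun fun nm => ?_
    simp only [c0, Δ0p, ℓ0p, Sum.elim_inl, Sum.elim_inr, genuineFamily, d12, d34]
  case ssss0p =>
    refine hasSum_of_inr (fun nm => by simp [a0]) (hasSum_of_inr (fun nm => by simp [a0]) ?_)
    refine (hasSum_evenFamily_two hq h).congr_fun fun nm => ?_
    simp only [a0, Δ0p, ℓ0p, Sum.elim_inr, genuineFamily, d12, d34]

/-- **Sector `0⁻`**: convergence channel by channel to `S0m`. [cite: ChesterEtAl2020, §2.1 (eq. (4point))]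
[cite: HenrikssonVanLoon2018, §2 (𝒢^{(0)}_A)] -/
theorem sector0m_hasSum (hp : 1 / 2 < p) (hr : 1 / 2 < r) (h : InDiamond u v) (σ : Sec) :
    HasSum (fun i => sec0m ((gffTriple p q r).b0m i) ((gffTriple p q r).c0m i) ((gffTriple p q r).g0m i) σ u v)
      (S0m p r σ u v) := by
  have hcb : ∀ i : I0m, c0m r i * b0m p i = 0 := by rintro (nm | nm) <;> simp [b0m, c0m]
  cases σ <;> simp only [gffTriple, sec0m, S0m, hcb, zero_mul, neg_zero] <;> try exact hasSum_zero
  case φφφφ0m =>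
    refine hasSum_of_inl ?_ (fun nm => by simp [b0m])
    refine (hasSum_oddFamily hp h).congr_fun fun nm => ?_
    simp only [b0m, Δ0m, ℓ0m, Sum.elim_inl, genuineFamily, d12, d34]
  case tttt0m =>
    refine hasSum_of_inr (fun nm => by simp [c0m]) ?_
    refine (hasSum_oddFamily hr h).congr_fun fun nm => ?_
    simp only [c0m, Δ0m, ℓ0m, Sum.elim_inr, genuineFamily, d12, d34]

/-- **Sector `1`**: convergence channel by channel to `S1` (signs `ε = (−1)^ℓ` on the `φsφs`, `tφtφ` rows).
[cite: ChesterEtAl2020, §2.1 (eq. (4point))] [cite: PolandRychkovVichi2019, §3.9.1 (Wick's theorem)] -/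
theorem sector1_hasSum (hp : 1 / 2 < p) (hq : 1 / 2 < q) (hr : 1 / 2 < r) (h : InDiamond u v) (σ : Sec) :
    HasSum (fun i => sec1 ((gffTriple p q r).x1 i) ((gffTriple p q r).y1 i) ((-1) ^ (gffTriple p q r).ℓ1 i)
      ((gffTriple p q r).g1 i) σ u v) (S1 p q r σ u v) := by
  have hxy : ∀ i : I1, x1 p q i * y1 p r i = 0 := by rintro (nl | nl) <;> simp [x1, y1]
  cases σ <;> simp only [gffTriple, sec1, S1, hxy, zero_mul, mul_zero] <;> try exact hasSum_zero
  case sφφs1 =>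
    refine hasSum_of_inl ?_ (fun nl => by simp [x1])
    refine (hasSum_typeII hp hq h).congr_fun fun nl => ?_
    simp only [x1, Δ1, ℓ1, Sum.elim_inl, genuineFamily, d12, d34, dims]
  case φsφs1 =>
    refine hasSum_of_inl ?_ (fun nl => by simp [x1])
    refine (hasSum_typeI hp hq h).congr_fun fun nl => ?_
    simp only [x1, Δ1, ℓ1, Sum.elim_inl, genuineFamily, d12, d34, dims]
  case φttφ1 =>
    have e : u ^ ((p + r) / 2) / v ^ r = u ^ ((r + p) / 2) / v ^ r := by rw [add_comm]
    rw [e]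
    refine hasSum_of_inr (fun nl => by simp [y1]) ?_
    refine (hasSum_typeII hr hp h).congr_fun fun nl => ?_
    simp only [y1, Δ1, ℓ1, Sum.elim_inr, genuineFamily, d12, d34, dims]
  case tφtφ1 =>
    have e : u ^ ((p + r) / 2) = u ^ ((r + p) / 2) := by rw [add_comm]
    rw [e]
    refine hasSum_of_inr (fun nl => by simp [y1]) ?_
    refine (hasSum_typeI hr hp h).congr_fun fun nl => ?_
    simp only [y1, Δ1, ℓ1, Sum.elim_inr, genuineFamily, d12, d34, dims]

/-- **Sector `2⁺`**: convergence channel by channel to `S2p` (`[φφ]` and the even-spin `[ts]`).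
[cite: ChesterEtAl2020, §2.1 (eq. (4point))] [cite: PolandRychkovVichi2019, §3.9.1 (Wick's theorem)] -/
theorem sector2p_hasSum (hp : 1 / 2 < p) (hq : 1 / 2 < q) (hr : 1 / 2 < r) (h : InDiamond u v) (σ : Sec) :
    HasSum (fun i => sec2p ((gffTriple p q r).b2 i) ((gffTriple p q r).z2 i) ((gffTriple p q r).g2p i) σ u v)
      (S2p p q r σ u v) := by
  have hbz : ∀ i : I2p, b2 p i * z2 q r i = 0 := by rintro (nm | i) <;> simp [b2, z2]
  cases σ <;> simp only [gffTriple, sec2p, S2p, hbz, zero_mul] <;> try exact hasSum_zero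
  case φφφφ2 =>
    refine hasSum_of_inl ?_ (fun i => by simp [b2])
    refine (hasSum_evenFamily_two hp h).congr_fun fun nm => ?_
    simp only [b2, Δ2p, ℓ2p, Sum.elim_inl, genuineFamily, d12, d34]
  case tsts2 =>
    refine hasSum_of_inr (fun nm => by simp [z2]) ?_
    refine (hasSum_fI_even hq hr h).congr_fun fun i => ?_
    have hi : Even i.1.2 := i.2
    simp only [z2, Δ2p, ℓ2p, Sum.elim_inr, genuineFamily, d12, d34, dims, fI]
    rw [Even.neg_one_pow hi, one_mul]
  case stts2 =>
    refine hasSum_of_inr (fun nm => by simp [z2]) ?_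
    refine (hasSum_fII_even hq hr h).congr_fun fun i => ?_
    simp only [z2, Δ2p, ℓ2p, Sum.elim_inr, genuineFamily, d12, d34, dims, fII]

/-- **Sector `2⁻`**: convergence channel by channel to `S2m` (the odd-spin `[ts]`, with the sign of the `tsts`
row). [cite: ChesterEtAl2020, §2.1 (eq. (4point))] [cite: PolandRychkovVichi2019, §3.9.1 (Wick's theorem)] -/
theorem sector2m_hasSum (hq : 1 / 2 < q) (hr : 1 / 2 < r) (h : InDiamond u v) (σ : Sec) :
    HasSum (fun i => sec2m ((gffTriple p q r).lam2m i ^ 2) ((gffTriple p q r).g2m i) σ u v)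
      (S2m q r σ u v) := by
  cases σ <;> simp only [gffTriple, sec2m, S2m] <;> try exact hasSum_zero
  case tsts2 =>
    refine (hasSum_fI_odd hq hr h).congr_fun fun i => ?_
    have hi : ¬Even i.1.2 := i.2
    simp only [lam2m, Δ2m, ℓ2m, genuineFamily, d12, d34, dims, fI]
    rw [Odd.neg_one_pow (Nat.not_even_iff_odd.mp hi)]
    ring
  case stts2 =>
    refine (hasSum_fII_odd hq hr h).congr_fun fun i => ?_
    simp only [lam2m, Δ2m, ℓ2m, genuineFamily, d12, d34, dims, fII]

/-- **Sector `3`**: convergence channel by channel to `S3` (signs `ε = (−1)^ℓ` on the `tφtφ` row).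
[cite: ChesterEtAl2020, §2.1 (eq. (4point))] [cite: PolandRychkovVichi2019, §3.9.1 (Wick's theorem)] -/
theorem sector3_hasSum (hp : 1 / 2 < p) (hr : 1 / 2 < r) (h : InDiamond u v) (σ : Sec) :
    HasSum (fun i => sec3 ((gffTriple p q r).lam3 i ^ 2) ((-1) ^ (gffTriple p q r).ℓ3 i)
      ((gffTriple p q r).g3 i) σ u v) (S3 p r σ u v) := by
  cases σ <;> simp only [gffTriple, sec3, S3] <;> try exact hasSum_zero
  case φttφ3 =>
    have e : u ^ ((p + r) / 2) / v ^ r = u ^ ((r + p) / 2) / v ^ r := by rw [add_comm]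
    rw [e]
    refine (hasSum_typeII hr hp h).congr_fun fun nl => ?_
    simp only [lam3, Δ3, genuineFamily, d12, d34, dims]
  case tφtφ3 =>
    have e : u ^ ((p + r) / 2) = u ^ ((r + p) / 2) := by rw [add_comm]
    rw [e]
    refine (hasSum_typeI hr hp h).congr_fun fun nl => ?_
    simp only [lam3, Δ3, genuineFamily, d12, d34, dims]

/-- **Sector `4`**: convergence channel by channel to `S4`. [cite: ChesterEtAl2020, §2.1 (eq. (4point))]
[cite: HenrikssonVanLoon2018, §2 (generalized free correlator, N = 1)] -/
theorem sector4_hasSum (hr : 1 / 2 < r) (h : InDiamond u v) (σ : Sec) :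
    HasSum (fun i => sec4 ((gffTriple p q r).lam4 i ^ 2) ((gffTriple p q r).g4 i) σ u v) (S4 r σ u v) := by
  cases σ <;> simp only [gffTriple, sec4, S4] <;> try exact hasSum_zero
  case tttt4 =>
    refine (hasSum_evenFamily_two hr h).congr_fun fun nm => ?_
    simp only [lam4, Δ4, genuineFamily, d12, d34]

/-! ### The grouped total channel sums are those of `O2CrossingNonVacuity.gffSums` -/

/-- **The grouped totals** (unit + externals at `λ_ext = 0` + the seven sectors) of the decoupled triple are,
as FUNCTIONS of `(u,v)`, the Wick channel sums `gffSums (Δ_s, Δ_φ, Δ_t)` of `O2CrossingNonVacuity`.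
[cite: ChesterEtAl2020, §3.1 (unit, λ_ext, V⃗_ext)] [cite: PolandRychkovVichi2019, §3.9.1 (Wick's theorem)] -/
theorem totalSums_gffTriple (p q r : ℝ) :
    totalSums (gffTriple p q r).lam (gffTriple p q r).gs (gffTriple p q r).gφ (gffTriple p q r).gt
      (S0p p q r) (S0m p r) (S1 p q r) (S2p p q r) (S2m q r) (S3 p r) (S4 r) = gffSums (dims p q r) := by
  funext σ u v
  cases σ <;>
    simp only [totalSums, Pi.add_apply, gffTriple, Pi.zero_apply, sec0p, sec1, sec2p, S0p, S0m, S1, S2p,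
      S2m, S3, S4, gffSums, unitBlocks, dims, gffT, gff1, gffAsrc] <;>
    ring

/-- **Flavour-space crossing of the decoupled triple** at every diamond point: the seven sector expansions
converge channel by channel at `(u,v)` and `(v,u)`, and the grouped totals are `O(2)`-crossing symmetric there
(`o2CrossingAt_gff`). [cite: ChesterEtAl2020, §2.1 (eq. (4point))] [cite: PolandRychkovVichi2019, §3.9.1 (Wick's theorem)] -/
theorem flavourCrossingAt_gffTriple (hp : 1 / 2 < p) (hq : 1 / 2 < q) (hr : 1 / 2 < r) (h : InDiamond u v) :
    FlavourCrossingAt (gffTriple p q r) (S0p p q r) (S0m p r) (S1 p q r) (S2p p q r) (S2m q r) (S3 p r)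
      (S4 r) u v := by
  refine ⟨⟨sector0p_hasSum hp hq hr h, sector0p_hasSum hp hq hr h.symm⟩,
    ⟨sector0m_hasSum hp hr h, sector0m_hasSum hp hr h.symm⟩,
    ⟨sector1_hasSum hp hq hr h, sector1_hasSum hp hq hr h.symm⟩,
    ⟨sector2p_hasSum hp hq hr h, sector2p_hasSum hp hq hr h.symm⟩,
    ⟨sector2m_hasSum hq hr h, sector2m_hasSum hq hr h.symm⟩,
    ⟨sector3_hasSum hp hr h, sector3_hasSum hp hr h.symm⟩,
    ⟨sector4_hasSum hr h, sector4_hasSum hr h.symm⟩, ?_, ?_⟩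
  · rw [totalSums_gffTriple]
    exact o2CrossingAt_gff (dims p q r) h.pos.1 h.pos.2
  · rw [totalSums_gffTriple]
    exact o2CrossingAt_gff (dims p q r) h.pos.2 h.pos.1

end Sums

/-! ## §5 The typed axioms A1–A4, and what an excluded box can never contain -/

section Axioms

variable {p q r : ℝ}

/-- Plumbing: the scalar unitarity bound is `1/2`. [folklore] -/
private theorem unitarityBound3D_zero_eq : unitarityBound3D 0 = 1 / 2 := by
  simp [unitarityBound3D]

/-- Strict unitarity of the `0⁺` families. [cite: FitzpatrickKaplan2012, §2.2] [cite: PolandRychkovVichi2019, §II.C eq. (19)] -/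
theorem lt_Δ0p (hp : 1 / 2 < p) (hq : 1 / 2 < q) (hr : 1 / 2 < r) (i : I0p) :
    unitarityBound3D (ℓ0p i) < Δ0p p q r i := by
  rcases i with nm | nm | nm
  · have h := unitarityBound3D_lt_twist hp nm.1 (2 * nm.2)
    push_cast at h
    simpa only [Δ0p, ℓ0p, Sum.elim_inl] using h
  · have h := unitarityBound3D_lt_twist hr nm.1 (2 * nm.2)
    push_cast at h
    simpa only [Δ0p, ℓ0p, Sum.elim_inl, Sum.elim_inr] using h
  · have h := unitarityBound3D_lt_twist hq nm.1 (2 * nm.2)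
    push_cast at h
    simpa only [Δ0p, ℓ0p, Sum.elim_inr] using h

/-- Strict unitarity of the `0⁻` families. [cite: FitzpatrickKaplan2012, §2.2] [cite: PolandRychkovVichi2019, §II.C eq. (19)] -/
theorem lt_Δ0m (hp : 1 / 2 < p) (hr : 1 / 2 < r) (i : I0m) : unitarityBound3D (ℓ0m i) < Δ0m p r i := by
  rcases i with nm | nm
  · simpa only [Δ0m, ℓ0m, Sum.elim_inl] using unitarityBound3D_lt_twist hp nm.1 (2 * nm.2 + 1)
  · simpa only [Δ0m, ℓ0m, Sum.elim_inr] using unitarityBound3D_lt_twist hr nm.1 (2 * nm.2 + 1)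

/-- Strict unitarity of the charge-`1` families. [cite: FitzpatrickKaplan2012, §2.2] [cite: PolandRychkovVichi2019, §II.C eq. (19)] -/
theorem lt_Δ1 (hp : 1 / 2 < p) (hq : 1 / 2 < q) (hr : 1 / 2 < r) (i : I1) :
    unitarityBound3D (ℓ1 i) < Δ1 p q r i := by
  rcases i with nl | nl
  · simpa only [Δ1, ℓ1, Sum.elim_inl] using (gffV_blocks_typed hp hq nl.1 nl.2).1
  · simpa only [Δ1, ℓ1, Sum.elim_inr] using (gffV_blocks_typed hr hp nl.1 nl.2).1

/-- Strict unitarity of the `2⁺` families. [cite: FitzpatrickKaplan2012, §2.2] [cite: PolandRychkovVichi2019, §II.C eq. (19)] -/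
theorem lt_Δ2p (hp : 1 / 2 < p) (hq : 1 / 2 < q) (hr : 1 / 2 < r) (i : I2p) :
    unitarityBound3D (ℓ2p i) < Δ2p p q r i := by
  rcases i with nm | i
  · have h := unitarityBound3D_lt_twist hp nm.1 (2 * nm.2)
    push_cast at h
    simpa only [Δ2p, ℓ2p, Sum.elim_inl] using h
  · simpa only [Δ2p, ℓ2p, Sum.elim_inr] using (gffV_blocks_typed hr hq i.1.1 i.1.2).1

/-- Strict unitarity of the `2⁻` family. [cite: FitzpatrickKaplan2012, §2.2] [cite: PolandRychkovVichi2019, §II.C eq. (19)] -/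
theorem lt_Δ2m (hq : 1 / 2 < q) (hr : 1 / 2 < r) (i : I2m) : unitarityBound3D (ℓ2m i) < Δ2m q r i := by
  simpa only [Δ2m, ℓ2m] using (gffV_blocks_typed hr hq i.1.1 i.1.2).1

/-- Strict unitarity of the charge-`3` family. [cite: FitzpatrickKaplan2012, §2.2] [cite: PolandRychkovVichi2019, §II.C eq. (19)] -/
theorem lt_Δ3 (hp : 1 / 2 < p) (hr : 1 / 2 < r) (nl : ℕ × ℕ) : unitarityBound3D nl.2 < Δ3 p r nl := by
  simpa only [Δ3] using (gffV_blocks_typed hr hp nl.1 nl.2).1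

/-- Strict unitarity of the charge-`4` family. [cite: FitzpatrickKaplan2012, §2.2] [cite: PolandRychkovVichi2019, §II.C eq. (19)] -/
theorem lt_Δ4 (hr : 1 / 2 < r) (nm : ℕ × ℕ) : unitarityBound3D (2 * nm.2) < Δ4 r nm := by
  have h := unitarityBound3D_lt_twist hr nm.1 (2 * nm.2)
  push_cast at h
  simpa only [Δ4] using h

/-- **A2 for the decoupled triple**: every block family is genuine (externals above the scalar unitarity bound,
exchanged families above theirs). [cite: ChesterEtAl2020, §2.1 (`F^{ij,kl}_{∓,Δ,ℓ}`)] [cite: DolanOsborn2004, §3 eq. (3.11)] -/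
theorem gffTriple_hasGenuineBlocks (hp : 1 / 2 < p) (hq : 1 / 2 < q) (hr : 1 / 2 < r) :
    (gffTriple p q r).HasGenuineBlocks := by
  refine ⟨genuineOn_genuineFamily _ _ ?_, genuineOn_genuineFamily _ _ ?_, genuineOn_genuineFamily _ _ ?_,
    fun i => genuineOn_genuineFamily _ _ (lt_Δ0p hp hq hr i),
    fun i => genuineOn_genuineFamily _ _ (lt_Δ0m hp hr i),
    fun i => genuineOn_genuineFamily _ _ (lt_Δ1 hp hq hr i),
    fun i => genuineOn_genuineFamily _ _ (lt_Δ2p hp hq hr i),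
    fun i => genuineOn_genuineFamily _ _ (lt_Δ2m hq hr i),
    fun i => genuineOn_genuineFamily _ _ (lt_Δ3 hp hr i),
    fun i => genuineOn_genuineFamily _ _ (lt_Δ4 hr i)⟩
  · show unitarityBound3D 0 < q
    rw [unitarityBound3D_zero_eq]; exact hq
  · show unitarityBound3D 0 < p
    rw [unitarityBound3D_zero_eq]; exact hp
  · show unitarityBound3D 0 < r
    rw [unitarityBound3D_zero_eq]; exact hr

/-- **A1 for the decoupled triple**: external dimensions `≥ 1/2`, unitarity, and the spin parities of the sectors.
[cite: ChesterEtAl2020, §2.1 (crossing equations, Table 1)] [cite: FitzpatrickKaplan2012, §2.2] -/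
theorem gffTriple_satisfiesUnitarity (hp : 1 / 2 < p) (hq : 1 / 2 < q) (hr : 1 / 2 < r) :
    (gffTriple p q r).SatisfiesUnitarity := by
  refine ⟨hq.le, hp.le, hr.le, fun i => ⟨(lt_Δ0p hp hq hr i).le, ?_⟩, fun i => ⟨(lt_Δ0m hp hr i).le, ?_⟩,
    fun i => (lt_Δ1 hp hq hr i).le, fun i => ⟨(lt_Δ2p hp hq hr i).le, ?_⟩,
    fun i => ⟨(lt_Δ2m hq hr i).le, ?_⟩, fun i => (lt_Δ3 hp hr i).le, fun i => ⟨(lt_Δ4 hr i).le, ?_⟩⟩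
  · rcases i with nm | nm | nm <;> exact even_two_mul _
  · rcases i with nm | nm <;> exact odd_two_mul_add_one _
  · rcases i with nm | i
    · exact even_two_mul _
    · exact i.2
  · exact Nat.not_even_iff_odd.mp i.2
  · exact even_two_mul _

/-- **A3 for the decoupled triple** (`SatisfiesCrossing`, the grouped 22-row equation with the quoted vectors):
from flavour-space crossing at every diamond point, by `satisfiesCrossing_of_flavourCrossing`.
[cite: ChesterEtAl2020, §2.1 (crossing equations)] [cite: PolandRychkovVichi2019, §3.9.1 (Wick's theorem)] -/
theorem gffTriple_satisfiesCrossing (hp : 1 / 2 < p) (hq : 1 / 2 < q) (hr : 1 / 2 < r) :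
    (gffTriple p q r).SatisfiesCrossing :=
  satisfiesCrossing_of_flavourCrossing _ fun _ _ hz hzb =>
    flavourCrossingAt_gffTriple hp hq hr (inDiamond_of_mem hz hzb)

/-- The three inequalities `min(p,q,r) ≤ p, q, r`. Plumbing. [folklore] -/
private theorem min3_le (p q r : ℝ) :
    min p (min q r) ≤ p ∧ min p (min q r) ≤ q ∧ min p (min q r) ≤ r :=
  ⟨min_le_left _ _, (min_le_right _ _).trans (min_le_left _ _), (min_le_right _ _).trans (min_le_right _ _)⟩

/-- **A4 for the decoupled triple against `gffGaps p q r`**: the scalar thresholds and the twist gap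
`δτ = 2 min(p,q,r) − 1` (every exchanged primary is double-twist). [cite: ChesterEtAl2020, §2.2 (assumptions about the spectrum)]
[cite: FitzpatrickKaplan2012, §2.2] -/
theorem gffTriple_satisfiesGaps (p q r : ℝ) : (gffTriple p q r).SatisfiesGaps (gffGaps p q r) := by
  obtain ⟨m1, m2, m3⟩ := min3_le p q r
  have a1 := min_le_left (2 * p) (min (2 * q) (2 * r))
  have a2 : min (2 * p) (min (2 * q) (2 * r)) ≤ 2 * q := (min_le_right _ _).trans (min_le_left _ _)
  have a3 : min (2 * p) (min (2 * q) (2 * r)) ≤ 2 * r := (min_le_right _ _).trans (min_le_right _ _)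
  have b1 := min_le_left (p + q) (p + r)
  have b2 := min_le_right (p + q) (p + r)
  have c1 := min_le_left (2 * p) (q + r)
  have c2 := min_le_right (2 * p) (q + r)
  refine ⟨fun i _ => ?_, fun i _ => ?_, fun i _ => ?_, fun i _ => ?_, fun i _ => ?_, fun i _ => Or.inr ?_,
    fun i => Or.inr ?_, fun i _ => ?_, fun i _ => ?_, fun i => ?_, fun i _ => ?_, fun i _ => ?_⟩
  · rcases i with nm | nm | nm <;> simp only [gffTriple, gffGaps, Δ0p, Sum.elim_inl, Sum.elim_inr] <;>
      linarith [Nat.cast_nonneg (α := ℝ) nm.1, Nat.cast_nonneg (α := ℝ) nm.2]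
  · rcases i with nl | nl <;> simp only [gffTriple, gffGaps, Δ1, Sum.elim_inl, Sum.elim_inr] <;>
      linarith [Nat.cast_nonneg (α := ℝ) nl.1, Nat.cast_nonneg (α := ℝ) nl.2]
  · rcases i with nm | i <;> simp only [gffTriple, gffGaps, Δ2p, Sum.elim_inl, Sum.elim_inr]
    · linarith [Nat.cast_nonneg (α := ℝ) nm.1, Nat.cast_nonneg (α := ℝ) nm.2]
    · linarith [Nat.cast_nonneg (α := ℝ) i.1.1, Nat.cast_nonneg (α := ℝ) i.1.2]
  · simp only [gffTriple, gffGaps, Δ3]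
    linarith [Nat.cast_nonneg (α := ℝ) i.1, Nat.cast_nonneg (α := ℝ) i.2]
  · simp only [gffTriple, gffGaps, Δ4]
    linarith [Nat.cast_nonneg (α := ℝ) i.1, Nat.cast_nonneg (α := ℝ) i.2]
  · rcases i with nm | nm | nm <;> simp only [gffTriple, gffGaps, Δ0p, ℓ0p, Sum.elim_inl, Sum.elim_inr] <;>
      push_cast <;> linarith [Nat.cast_nonneg (α := ℝ) nm.1, Nat.cast_nonneg (α := ℝ) nm.2]
  · rcases i with nm | nm <;> simp only [gffTriple, gffGaps, Δ0m, ℓ0m, Sum.elim_inl, Sum.elim_inr] <;>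
      push_cast <;> linarith [Nat.cast_nonneg (α := ℝ) nm.1, Nat.cast_nonneg (α := ℝ) nm.2]
  · rcases i with nl | nl <;> simp only [gffTriple, gffGaps, Δ1, ℓ1, Sum.elim_inl, Sum.elim_inr] <;>
      linarith [Nat.cast_nonneg (α := ℝ) nl.1, Nat.cast_nonneg (α := ℝ) nl.2]
  · rcases i with nm | i <;> simp only [gffTriple, gffGaps, Δ2p, ℓ2p, Sum.elim_inl, Sum.elim_inr]
    · push_cast
      linarith [Nat.cast_nonneg (α := ℝ) nm.1, Nat.cast_nonneg (α := ℝ) nm.2]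
    · linarith [Nat.cast_nonneg (α := ℝ) i.1.1, Nat.cast_nonneg (α := ℝ) i.1.2]
  · simp only [gffTriple, gffGaps, Δ2m, ℓ2m]
    linarith [Nat.cast_nonneg (α := ℝ) i.1.1, Nat.cast_nonneg (α := ℝ) i.1.2]
  · simp only [gffTriple, gffGaps, Δ3]
    linarith [Nat.cast_nonneg (α := ℝ) i.1, Nat.cast_nonneg (α := ℝ) i.2]
  · simp only [gffTriple, gffGaps, Δ4]
    push_cast
    linarith [Nat.cast_nonneg (α := ℝ) i.1, Nat.cast_nonneg (α := ℝ) i.2]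

/-- **Non-vacuity of the typed `O(2)` axioms.**  For all `p, q, r > 1/2`, the decoupled triple of generalised free
fields satisfies A1–A4 of `O2ThreeScalarSystem` against `gffGaps p q r`. [cite: ChesterEtAl2020, §2.2 (assumptions about the spectrum)]
[cite: PolandRychkovVichi2019, §3.9.1 (generalised free fields, Wick's theorem)] [cite: FitzpatrickKaplan2012, §2.2] -/
theorem gffTriple_satisfiesO2Axioms (hp : 1 / 2 < p) (hq : 1 / 2 < q) (hr : 1 / 2 < r) :
    (gffTriple p q r).SatisfiesO2Axioms (gffGaps p q r) :=
  ⟨gffTriple_hasGenuineBlocks hp hq hr, gffTriple_satisfiesUnitarity hp hq hr, gffTriple_satisfiesCrossing hp hq hr,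
    gffTriple_satisfiesGaps p q r⟩

/-- The same against any weaker assumptions `A`. [cite: ChesterEtAl2020, §2.2 (assumptions about the spectrum)] -/
theorem gffTriple_satisfiesO2Axioms_of_weaker {A : O2Gaps} (hp : 1 / 2 < p) (hq : 1 / 2 < q) (hr : 1 / 2 < r)
    (hw : A.Weaker (gffGaps p q r)) : (gffTriple p q r).SatisfiesO2Axioms A :=
  (gffTriple_satisfiesO2Axioms hp hq hr).of_weaker hw

/-- **What an excluded box can never contain.**  If `Q` is excluded against assumptions `A` no stronger than
`gffGaps p q r` (`p, q, r > 1/2`), then `(Δ_s, Δ_φ, Δ_t) = (q, p, r) ∉ Q`: a certificate claiming otherwise would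
contradict the decoupled triple. [cite: ChesterEtAl2020, §3.3 (allowed and disallowed points)]
[cite: PolandRychkovVichi2019, §3.9.1 (generalised free fields)] -/
theorem not_mem_of_boxExcluded {A : O2Gaps} {Q : Set (ℝ × ℝ × ℝ)} (h : BoxExcluded A Q) (hp : 1 / 2 < p)
    (hq : 1 / 2 < q) (hr : 1 / 2 < r) (hw : A.Weaker (gffGaps p q r)) : (q, p, r) ∉ Q :=
  h (gffTriple p q r) (gffTriple_satisfiesO2Axioms_of_weaker hp hq hr hw)

/-- Contrapositive: a set containing an admitted generalised-free point is not excluded.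
[cite: ChesterEtAl2020, §3.3 (allowed and disallowed points)] -/
theorem not_boxExcluded_of_mem {A : O2Gaps} {Q : Set (ℝ × ℝ × ℝ)} (hp : 1 / 2 < p) (hq : 1 / 2 < q)
    (hr : 1 / 2 < r) (hw : A.Weaker (gffGaps p q r)) (hQ : (q, p, r) ∈ Q) : ¬BoxExcluded A Q :=
  fun h => not_mem_of_boxExcluded h hp hq hr hw hQ

/-- **Every enclosure keeps the admitted generalised-free points of its window**: if `O2Enclosure A W R` with
`A` no stronger than `gffGaps p q r` and `(q, p, r) ∈ W`, then `(q, p, r) ∈ R` — the typed reason the source needs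
BOTH a bounded window and genuine spectral assumptions to carve an island.
[cite: ChesterEtAl2020, §3.3 (allowed and disallowed points)] [cite: PolandRychkovVichi2019, §3.9.1 (generalised free fields)] -/
theorem mem_of_o2Enclosure {A : O2Gaps} {W R : Set (ℝ × ℝ × ℝ)} (h : O2Enclosure A W R) (hp : 1 / 2 < p)
    (hq : 1 / 2 < q) (hr : 1 / 2 < r) (hw : A.Weaker (gffGaps p q r)) (hW : (q, p, r) ∈ W) : (q, p, r) ∈ R :=
  h (gffTriple p q r) (gffTriple_satisfiesO2Axioms_of_weaker hp hq hr hw) hW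

/-- The source's own assumptions are NOT weaker than `gffGaps` at its island (`Δ_φ ≈ 0.519 < 3/2` forces
`gffGaps.Δ0 ≤ 2Δ_φ < 3 = chesterGaps.Δ0`): the decoupled triple is no obstruction to the printed exclusions, as it
must not be. [cite: ChesterEtAl2020, §2.2 (assumptions about the spectrum: Δ ≥ 3 for the irrelevant neutral scalars)] -/
theorem not_chesterGaps_weaker (hp : p < 3 / 2) (q r : ℝ) : ¬chesterGaps.Weaker (gffGaps p q r) := by
  intro hw
  have h0 := hw.1
  simp only [chesterGaps, gffGaps] at h0
  have := min_le_left (2 * p) (min (2 * q) (2 * r))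
  linarith

end Axioms

end Literature.MathematicalPhysics.QuantumFieldTheory.O2DecoupledNonVacuity

end
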